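import Summits.BirchSwinnertonDyer.Rank1Residual.Partition.CornersDecide
import Summits.BirchSwinnertonDyer.Rank1Residual.Partition.CornersCM
import Literature.NumberTheory.EllipticCurves.Rank1Residual.X9NoEntry
import HarnessLib

/-!
# The named corners are SHARP relative to the fourteen inputs: on a corner pair NO covered row
# applies (cell `b2b-bsdres`, RESIDUAL-MAP.md §I HEADLINE; corners-writer GEN 5, companion of the
# referee packet `HOME/corners/`, paper §5 / STATEMENT.md §2.3 'SHARPNESS')

HONEST FRAMING (run/shared/lean/b2b/bsd-rank1-residual/, verbatim in every file): the goal of the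
cell is to DELETE the COMBINATION-SHAPED residual classes of the Birch–Swinnerton-Dyer formula for
ALL analytic-rank `≤ 1` elliptic curves over `ℚ` — "full BSD formula for every rank `≤ 1` curve in
class `C`" assembled STRICTLY from published theorems — so that the rank-`≤ 1` remainder becomes
exactly the CONSTRUCTION-SHAPED classes, which are TYPED (missing-input `Prop`s), NOT attempted.
This is not "finishing BSD". Theorems and ONE Boolean bookkeeping definition only; NO named fact, NO
Literature statement; nothing about any particular curve is asserted; no label changes; nothing is
booked. This file is the CONVERSE companion of `Partition/CornersDecide.lean` (rmap-1 gen 4).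

`CornersDecide` checks by `decide` that OUTSIDE the eight non-CM corners every consistent domain
cell is a covered cell (`Cell.covered_of_not_corner`), hence `covered_of_not_corners`. The converse
— INSIDE a corner NO class-level covered row C1 / C2 / C3 / C6 / C7 / C8 / C10 / C16 / C17 applies —
is what "the headline is sharp as bookkeeping relative to its fourteen inputs" means. At cell level
it is FALSE on exactly 48 of the 1 488 corner cells of the domain (the referee packet's probe,
`HOME/corners/AXIOMS.md` §2f): the cells with SMALL IRREDUCIBLE image and `ram = true` (X9 ∧ r = 0 ∧
ram is formally a C1 cell; X10 ∧ ¬surj ∧ r = 1 ∧ ¬sst ∧ ram is formally a C16 cell through the `Ram`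
disjunct). No curve has such a cell: a ramified multiplicative prime `ℓ ≠ p` supplies a transvection
in the image of `ρ̄_{E,p}`, and an irreducible subgroup of `GL₂(𝔽_p)` containing a transvection is
all of it (Serre 1972 Prop. 15 + Tate; tree theorem `not_ram_of_irr_of_not_surj`, X9 prover gen 2,
`Literature/…/Rank1Residual/X9NoEntry.lean`). So this file

1. adds the Boolean constraint `Cell.tateConsistent := !(smallIrr ∧ ram)` and proves every real pair
   satisfies it (`cellOf_tateConsistent`);
2. checks by `decide +kernel` over the 36 864 cells that a consistent, Serre-consistent,
   Tate-consistent domain cell which IS a corner cell is NOT a covered cell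
   (`Cell.not_covered_of_corner`; spec `Cell.cornerSharpSpec`);
3. reflects `Covered W p` back onto the cell (`cellOf_covered_of_covered`, the converse of
   `Partition.covered_of_cell`) and concludes `not_covered_of_corners`: for non-CM `W` of analytic
   rank `≤ 1` at an odd `p`, good or (multiplicative with `r = 0`), lying in one of the eight corners
   X1 / X9 / X10∧¬surj / X6∧r=0 / X7 / X8 / X11a / X2, NONE of the covered rows holds — with
   `covered_of_not_corners` this gives `covered_iff_not_corners` (on the headline's domain, COVERED
   ⟺ outside the corners);
4. proves the same for the CM corner directly on the `Prop`s (`not_covered_of_cornerF`: a CM curve of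
   analytic rank one at `p = 2`, or at an odd bad prime not split in `K`, meets no row — rows C2/C7
   ask `¬cm`, C1/C8 rank `0`, C3 semistability (false for CM: `not_semistable_of_hasCM`), C6/C10/C16
   good reduction at an odd `p`, C17 a split `p`).

Nothing here bears on the STATUS of any cell of RESIDUAL-MAP §I: 'no covered ROW applies' is a
statement about the fourteen transcribed hypothesis sets, not about the published record at large
(the map's further in-tree closures inside K8 — X2a, `CornersMultTargetA` — and K9 — the `p = 2`
good-ordinary CM sub-cell, `CornerFSharp` — use inputs that are not among the fourteen).

References: RESIDUAL-MAP.md §I HEADLINE; `Partition/CornersDecide.lean` (p243863), `Partition/Rows.lean`,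
`Partition/CellOf.lean`, `Partition.lean` (`covered_of_cell`, `rowHolds_of_cell`),
`Literature/…/Rank1Residual/X9NoEntry.lean` (`not_ram_of_irr_of_not_surj`); J.-P. Serre, Invent.
Math. 15 (1972) Prop. 15; referee packet `HOME/corners/` (STATEMENT.md §2.3, AUDIT.md §5.4).
-/

namespace Summit.BirchSwinnertonDyer.Rank1Residual

namespace Cell

variable (c : Cell)

/-! ## §1 The Tate–Serre constraint and the finite verification -/

/-- The Tate–Serre constraint at cell level: a SMALL IRREDUCIBLE image (irr ∧ ¬surj) excludes
ram(p) — a ramified multiplicative `ℓ ≠ p` puts a transvection in the image, and an irreducible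
subgroup of `GL₂(𝔽_p)` with a transvection is everything (Serre 1972 Prop. 15). Every real pair
satisfies it (`cellOf_tateConsistent`). [folklore] -/
def tateConsistent : Bool := !(c.smallIrr && c.ram)

/-- The specification checked on the grid: a consistent, Serre-consistent, Tate-consistent domain
cell inside the corner is NOT a covered cell. [folklore] -/
def cornerSharpSpec : Bool :=
  !(c.consistent && c.serreConsistent && c.tateConsistent && c.headlineDomain && c.corner) ||
    !c.covered

/-- Raw form over the grid coordinates (the shape the kernel evaluates). [folklore] -/
theorem cornerSharpSpec_raw :
    ∀ (pk : PK) (red : RedK) (im : ImK) (bigIm : Bool) (rk : RK)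
      (cm ram sst anom gvpar a3zero cmSplit cmRam : Bool),
      (Cell.mk pk red im bigIm rk cm ram sst anom gvpar a3zero cmSplit cmRam).cornerSharpSpec = true := by
  decide +kernel

/-- `cornerSharpSpec` holds on all 36 864 cells. [folklore] -/
theorem cornerSharpSpec_holds (c : Cell) : c.cornerSharpSpec = true := by
  obtain ⟨pk, red, im, bigIm, rk, cm, ram, sst, anom, gvpar, a3zero, cmSplit, cmRam⟩ := c
  exact cornerSharpSpec_raw ..

/-- **Inside the corner no consistent domain cell is a covered cell** (finite check; the converse
of `Cell.covered_of_not_corner`, under the extra Tate–Serre constraint without which exactly 48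
unrealizable cells — small irreducible image with ram — would be formal exceptions). [folklore] -/
theorem not_covered_of_corner (c : Cell) (hc : c.consistent = true) (hs : c.serreConsistent = true)
    (ht : c.tateConsistent = true) (hd : c.headlineDomain = true) (hk : c.corner = true) :
    c.covered = false := by
  have h := cornerSharpSpec_holds c
  simp only [cornerSharpSpec, hc, hs, ht, hd, hk, Bool.and_self, Bool.not_true, Bool.false_or,
    Bool.not_eq_true'] at h
  exact h

/-- On the headline's domain, for consistent (Serre- and Tate-consistent) cells, CORNER and COVERED
are complementary: `c.corner = !c.covered`. [folklore] -/
theorem corner_eq_not_covered (c : Cell) (hc : c.consistent = true) (hs : c.serreConsistent = true)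
    (ht : c.tateConsistent = true) (hd : c.headlineDomain = true) : c.corner = !c.covered := by
  cases hk : c.corner
  · rw [covered_of_not_corner c hc hs hd hk]; rfl
  · rw [not_covered_of_corner c hc hs ht hd hk]; rfl

end Cell

/-! ## §2 Binding to curves -/

section Curve

open WeierstrassCurve Literature.NumberTheory.EllipticCurves
  Literature.NumberTheory.EllipticCurves.Rank1Residual

variable {W : WeierstrassCurve ℚ} [W.IsElliptic] [W.IsGloballyMinimal] {p : ℕ} [Fact p.Prime]

/-- Every real pair is Tate-consistent: `irr(p) ∧ ¬surj(p) ⇒ ¬ram(p)`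
(`not_ram_of_irr_of_not_surj`, Serre 1972 Prop. 15 + Tate). [cite: Serre1972, Prop. 15] -/
theorem cellOf_tateConsistent : (cellOf W p).tateConsistent = true := by
  simp only [Cell.tateConsistent, Bool.not_eq_true', Bool.and_eq_false_imp]
  intro hsi
  obtain ⟨hirr, hns⟩ := (cellOf_smallIrr W p).1 hsi
  exact (cellOf_ram_false W p).2 (not_ram_of_irr_of_not_surj W p hirr hns)

/-- **Inside a named corner the pair's cell is NOT a covered cell** (domain of the headline):
finite table + reflection. [folklore] -/
theorem cellOf_covered_false_of_corners (hr : W.analyticRank ≤ 1) (hcm : ¬ W.HasCM) (hp : p ≠ 2)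
    (hdom : Good W p ∨ (Mult W p ∧ W.analyticRank = 0))
    (hK : ClassX1 W p ∨ ClassX9 W p ∨ (ClassX10 W p ∧ ¬ Surj W p) ∨
      (ClassX6 W p ∧ W.analyticRank = 0) ∨ ClassX7 W p ∨ ClassX8 W p ∨ ClassX11a W p ∨ ClassX2 W p) :
    (cellOf W p).covered = false :=
  Cell.not_covered_of_corner (cellOf W p) (cellOf_consistent W p) cellOf_serreConsistent
    cellOf_tateConsistent (cellOf_headlineDomain hcm hp hdom) (cellOf_corner_of_corners hr hK)

/-- Reflection of `Covered` onto the cell — the converse of `Partition.covered_of_cell`: if one of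
the nine class-level covered rows holds at `(E, p)` (its hypotheses as the tree states them), the
cell's Boolean `covered` is `true`. [folklore] -/
theorem cellOf_covered_of_covered (hr : W.analyticRank ≤ 1) (h : Covered W p) :
    (cellOf W p).covered = true := by
  have key : ∀ r : Cell.Row, RowHolds W p r → r.holds (cellOf W p) = true := by
    intro r hrow
    cases r <;>
      simp only [Cell.Row.holds, Cell.rowC1, Cell.rowC2, Cell.rowC3, Cell.rowC6, Cell.rowC7,
        Cell.rowC8, Cell.rowC10, Cell.rowC16, Cell.rowC17, Bool.and_eq_true, Bool.or_eq_true,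
        Bool.not_eq_true', and_assoc, cellOf_r0, cellOf_r1 W p hr, cellOf_ge3, cellOf_gt3,
        cellOf_ge5, cellOf_gt2, cellOf_odd, cellOf_isThree, cellOf_goodOrd, cellOf_good, cellOf_mult,
        cellOf_irr, cellOf_isRed, cellOf_surj, cellOf_ram, cellOf_cm, cellOf_cm_false, cellOf_sst,
        cellOf_anom_false, cellOf_gvpar, cellOf_a3zero, cellOf_bigIm, cellOf_cmSplit] <;>
      exact hrow
  simp only [Cell.covered, Bool.or_eq_true]
  rcases h with h | h | h | h | h | h | h | h | h
  · exact Or.inl <| Or.inl <| Or.inl <| Or.inl <| Or.inl <| Or.inl <| Or.inl <| Or.inl (key .C1 h)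
  · exact Or.inl <| Or.inl <| Or.inl <| Or.inl <| Or.inl <| Or.inl <| Or.inl <| Or.inr (key .C2 h)
  · exact Or.inl <| Or.inl <| Or.inl <| Or.inl <| Or.inl <| Or.inl <| Or.inr (key .C3 h)
  · exact Or.inl <| Or.inl <| Or.inl <| Or.inl <| Or.inl <| Or.inr (key .C6 h)
  · exact Or.inl <| Or.inl <| Or.inl <| Or.inl <| Or.inr (key .C7 h)
  · exact Or.inl <| Or.inl <| Or.inl <| Or.inr (key .C8 h)
  · exact Or.inl <| Or.inl <| Or.inr (key .C10 h)
  · exact Or.inl <| Or.inr (key .C16 h)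
  · exact Or.inr (key .C17 h)

/-- **THE CORNERS ARE SHARP RELATIVE TO THE FOURTEEN INPUTS (non-CM domain).** For `W/ℚ` globally
minimal, non-CM, of analytic rank `≤ 1`, and an odd prime `p` with `p` good or (`p` multiplicative
and `r = 0`): if `(W, p)` lies in one of the eight named corners X1 / X9 / X10∧¬surj / X6∧r=0 / X7 /
X8 / X11a / X2 of `Partition/Corners.lean`, then NONE of the class-level covered rows C1 / C2 / C3 /
C6 / C7 / C8 / C10 / C16 / C17 (the transcribed hypothesis sets of Skinner 2016 Thm C, BCS 2025
Cor 1.3.1, JSW 2017 Thm 1.2.1, CGS 2025 Thm D, the Greenberg–Vatsal chain, Rubin/Burungale–Flach,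
Kobayashi 2013 Cor 1.4, Yan–Zhu 2026 Thm 4.15 (+ Wuthrich L20 / (ram)), Li–Liu–Tian 2024) holds at
`(W, p)`. Finite table (`Cell.not_covered_of_corner`) + reflection; the one non-tabular input is
`not_ram_of_irr_of_not_surj` (Serre Prop. 15 + Tate). [folklore] -/
theorem not_covered_of_corners (hr : W.analyticRank ≤ 1) (hcm : ¬ W.HasCM) (hp : p ≠ 2)
    (hdom : Good W p ∨ (Mult W p ∧ W.analyticRank = 0))
    (hK : ClassX1 W p ∨ ClassX9 W p ∨ (ClassX10 W p ∧ ¬ Surj W p) ∨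
      (ClassX6 W p ∧ W.analyticRank = 0) ∨ ClassX7 W p ∨ ClassX8 W p ∨ ClassX11a W p ∨ ClassX2 W p) :
    ¬ Covered W p := fun h ↦ by
  have h1 := cellOf_covered_of_covered hr h
  rw [cellOf_covered_false_of_corners hr hcm hp hdom hK] at h1
  exact Bool.false_ne_true h1

/-- **On the headline's non-CM domain, COVERED ⟺ OUTSIDE THE CORNERS** (with
`CornersDecide.covered_of_not_corners`). [folklore] -/
theorem covered_iff_not_corners (hr : W.analyticRank ≤ 1) (hcm : ¬ W.HasCM) (hp : p ≠ 2)
    (hdom : Good W p ∨ (Mult W p ∧ W.analyticRank = 0)) :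
    Covered W p ↔
      ¬ (ClassX1 W p ∨ ClassX9 W p ∨ (ClassX10 W p ∧ ¬ Surj W p) ∨
        (ClassX6 W p ∧ W.analyticRank = 0) ∨ ClassX7 W p ∨ ClassX8 W p ∨ ClassX11a W p ∨ ClassX2 W p) := by
  constructor
  · exact fun hc hK ↦ not_covered_of_corners hr hcm hp hdom hK hc
  · intro hn
    simp only [not_or] at hn
    obtain ⟨hX1, hX9, hX10b, hX6, hX7, hX8, hX11a, hX2⟩ := hn
    exact covered_of_not_corners hr hcm hp hdom hX1 hX9 hX10b hX6 hX7 hX8 hX11a hX2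

/-- **The CM corner is sharp too**: a CM curve of analytic rank one at `p = 2`, or at an odd bad
prime not split in `K` (`CornerF`), meets NO covered row — C2/C7 ask `¬cm`, C1/C8 rank `0`, C3
semistability (a CM curve over `ℚ` is never semistable, `not_semistable_of_hasCM`), C6/C10/C16
good reduction at an odd `p`, C17 an odd split `p`. Direct on the `Prop`s (the grid is not needed).
[folklore] -/
theorem not_covered_of_cornerF (hF : CornerF W p) : ¬ Covered W p := by
  obtain ⟨hcm, hr1, hpF⟩ := hF
  rintro (h | h | h | h | h | h | h | h | h)
  · exact absurd h.1 (by omega)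
  · exact h.1 hcm
  · exact not_semistable_of_hasCM W hcm h.2.1
  · rcases hpF with h2 | ⟨-, hng⟩
    · exact absurd h.1 (by omega)
    · exact hng h.2.2.1
  · exact h.2.1 hcm
  · exact absurd h.2 (by omega)
  · rcases hpF with h2 | ⟨-, hng⟩
    · exact h.2.2.1 h2
    · exact hng h.2.2.2
  · rcases hpF with h2 | ⟨-, hng⟩
    · exact absurd h.1 (by omega)
    · exact hng h.2.1.1
  · rcases hpF with h2 | ⟨hns, -⟩
    · exact h.2.2.1 h2
    · exact hns h.2.2.2

/-- **All curves, the nine corners of `CornersAll.bsdp_allCurves_of_not_corner_of_not_cornerF`:**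
on the theorem's domain (`cm`, or `p` odd with `p` good or multiplicative-with-`r = 0`), a pair in a
corner — one of the eight non-CM corners when `¬cm`, `CornerF` when `cm` — satisfies NO covered row.
Together with `Corners.bsdp_of_not_corner` / `bsdp_cm_of_not_cornerF` (outside the corners a row
applies and gives `BSD(E,p)`): relative to the fourteen transcribed inputs the nine corners are
EXACTLY the part of the domain no row reaches. [folklore] -/
theorem not_covered_of_corner_allCurves (hr : W.analyticRank ≤ 1)
    (hdom : W.HasCM ∨ (p ≠ 2 ∧ (Good W p ∨ (Mult W p ∧ W.analyticRank = 0))))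
    (hK : (¬ W.HasCM ∧ (ClassX1 W p ∨ ClassX9 W p ∨ (ClassX10 W p ∧ ¬ Surj W p) ∨
        (ClassX6 W p ∧ W.analyticRank = 0) ∨ ClassX7 W p ∨ ClassX8 W p ∨ ClassX11a W p ∨ ClassX2 W p)) ∨
      (W.HasCM ∧ CornerF W p)) :
    ¬ Covered W p := by
  rcases hK with ⟨hcm, hK⟩ | ⟨hcm, hF⟩
  · rcases hdom with h | ⟨hp, hdom⟩
    · exact absurd h hcm
    · exact not_covered_of_corners hr hcm hp hdom hK
  · exact not_covered_of_cornerF hF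

end Curve

end Summit.BirchSwinnertonDyer.Rank1Residual
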